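import Literature.NumberTheory.EllipticCurves.PAdicLFunctionMinusMult
import Literature.NumberTheory.EllipticCurves.PAdicLFunctionMultiplicativeInterpolation
import Literature.NumberTheory.EllipticCurves.Greenberg1999.TwoTorsionMuInvariant
import Summits.BirchSwinnertonDyer.Rank1Residual.X1.MuLambdaAlgebra
import HarnessLib

/-!
# Cell `bsd-f1-sign2` (`p = 2`, non-CM) — candidate IMC-B `OddEvenCongruenceMultAtTwo`: at a
# MULTIPLICATIVE `2` (split or non-split), with `Δ_E < 0` and no rational `2`-torsion, the even and
# `ω`-odd `2`-adic `L`-functions agree in `𝔽₂⟦T⟧` after stripping `2`-powers (IMC lens, planner-of-record)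

HONEST FRAMING (typer seat `bsd-f1-sign2-ty`; HOME `run/shared/lean/pub/bsd-f1-sign2/`, CANDIDATES.md §2
row IMC-B): STATEMENTS ONLY — one predicate (`CongruentBranchesMult`) and one `@[conjecture] def` (OPEN
obligation, ours), re-filed VERBATIM from MEMO-imc.md c24861126774286b §3 (= planner's Sketch.lean
ae5c85f25580ee0d); nothing asserted, nothing booked, no named fact, PARTITION: none moved. Companion of
`F1Sign2/OddEvenCongruenceAtTwo.lean` (candidate A, crux K2, mechanism K1 — see its docstring for the lens
answer). REFUTER PASS: REF1-AUDIT-v1.md §3 — **SURVIVES [BC7 P3 timeout]** with one checkable consequence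
registered for data ask D-imc-1: at SPLIT `2` (`α = 1`) `IsMultPAdicLFunctionOf` has the exceptional zero
`L⁺(0) = 0`, so the congruence forces `T ∣ red(pfree L⁻)` on every split row — the odd-branch constant term
is never the `2`-adic minimum of its coefficients on split-at-`2`, `Δ < 0`, no-`2`-torsion classes; non-split
(`α = −1`): `L(0) = 2[0]⁺`, no forced zero. CM never multiplicative. REF2: pending at filing.

BC5 WITNESS (`pub/bsd-2adic/memos/ROUTE-L2-files/oddbranch_all.tsv` 5a0827a81e79746c): `λ(L⁻_ω) = λ(L⁺)`
on **267/267** multiplicative `Δ_{E′} < 0` rows (split 145/145, non-split 122/122); control `Δ > 0`: split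
10/54, non-split 11/63. Habitat inside row 1 (X5-AT2-TABLE-v1.tsv 6e587e04e023064c): 457 split + 832
non-split classes with `sign_disc_set = {−1}` (candidate B's exact habitat `mult, Δ<0, E′(ℚ)[2]=0` has 210
witness rows, 210/210). CHEAPEST FALSIFIER: as for A (0/221) — NOT KILLED. WHY NOVEL: MEMO-imc §6 (as for
A); located `2`-adic error term (E2) for the report: at split `2` Matsuno's ALGEBRAIC Thm. 5.1 has
`ε_{E,−1} = 1` while the analytic `λ`'s agree (145/145) — the additive twist's dual Selmer carries one
linear factor not seen by the `ω`-branch.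

References: [MazurTateTeitelbaum1986Invent] §I.13; [Matsuno2008] Thm. 5.1; HOME MEMO-imc.md §§3, 4, 9;
REF1-AUDIT-v1.md §3.
-/

set_option autoImplicit false

noncomputable section

open scoped Classical MatrixGroups ModularForm

open CongruenceSubgroup WeierstrassCurve Literature.NumberTheory.EllipticCurves
  Literature.NumberTheory.EllipticCurves.ModularForms Literature.NumberTheory.EllipticCurves.Greenberg1999
  Summit.BirchSwinnertonDyer.Rank1Residual.X1.MuLambda

namespace Summit.BirchSwinnertonDyer.Rank1Residual.F1Sign2

/-- **Congruent branches at a MULTIPLICATIVE `2` (predicate)**: for every `2`-adic `L`-function `Lp` of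
`f` at `α = a₂ = ±1` (`IsMultPAdicLFunctionOf f 2 α Lp`, one-term measure), all non-zero rationals
`cp, cm` and non-zero `Gp, Gm ∈ Λ` with `ι Gp = cp·Lp` and `ι Gm = cm·L₂(f,α,ω¹)`
(`padicLFunctionMinusBranchMult f α 1`): `red (pfree Gp) = red (pfree Gm)`. A DEFINITION; nothing
asserted. [cite: MazurTateTeitelbaum1986Invent, §I.13 (the branches; multiplicative case `ε(p) = 0`)] -/
def CongruentBranchesMult {N : ℕ} (f : CuspForm (Gamma0 N) 2) (α : ℚ_[2]) : Prop :=
  ∀ (Lp : PowerSeries ℚ_[2]) (cp cm : ℚ) (Gp Gm : IwasawaAlgebra 2),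
    IsMultPAdicLFunctionOf f 2 α Lp → cp ≠ 0 → cm ≠ 0 → Gp ≠ 0 → Gm ≠ 0 →
    iwasawaToPowerSeries 2 Gp = PowerSeries.C (cp : ℚ_[2]) * Lp →
    iwasawaToPowerSeries 2 Gm = PowerSeries.C (cm : ℚ_[2]) * padicLFunctionMinusBranchMult f α 1 →
    red (pfree Gp) = red (pfree Gm)

/-- **CANDIDATE IMC-B `OddEvenCongruenceMultAtTwo` (OPEN; cell `bsd-f1-sign2`, IMC lens, multiplicative
`2`).** For `E/ℚ` (globally minimal) with multiplicative reduction at `2` (split or non-split,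
`α = a₂(E) = ±1`), `Δ_E < 0` and no rational `2`-torsion, and its newform `f`: the even and `ω`-odd
`2`-adic `L`-functions agree in `𝔽₂⟦T⟧` after stripping `2`-powers (`CongruentBranchesMult f a₂`). REF1:
SURVIVES (split `2`: forces `T ∣ red(pfree L⁻)`, a registered prediction for D-imc-1). Witness: 267/267
multiplicative `Δ < 0` rows; habitat 1 289 X5 classes. [folklore] -/
@[conjecture] def OddEvenCongruenceMultAtTwo : Prop :=
  ∀ (W : WeierstrassCurve ℚ) [W.IsElliptic] [W.IsGloballyMinimal],
    W.HasMultiplicativeReductionAtPrime 2 → W.Δ < 0 → (∀ x : ℚ, ¬ HasRationalTwoTorsionX W x) →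
    ∀ ⦃N : ℕ⦄ [NeZero N] (f : CuspForm (Gamma0 N) 2), IsNewformOf W f →
      CongruentBranchesMult f (W.frobeniusTrace 2 : ℚ_[2])

end Summit.BirchSwinnertonDyer.Rank1Residual.F1Sign2

end
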